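import Mathlib
import Summits.Ventures.PercRepro2.SwOutCrossJunctionSwG

/-!
# An instance of Theorem A_cross for two components: a cross edge and a single dropped vertex at
one junction (blind cell PercRepro2, night-4 g25, 2026-08-28; proofs/NIGHT4-G25.md §5)

The graph `crossEx2` on `Fin 8` (`l = 0`, `h = 1`, `o = 2`, the junction `u = 3`, the dropped
vertices `p₁ = 4`, `p₂ = 5` joined by the CROSS EDGE `p₁p₂`, the single dropped vertex `p₃ = 6`,
the u-arm `x = 7`) with the eleven edges `hx, ux, up₁, up₂, up₃, p₁p₂, xl, p₁l, p₂l, p₃l, ol`.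
The dropped vertices form TWO components along the cross-edge graph `⊤ ⊕g ⊤` on
`Fin 2 ⊕ Fin 1`; the cross junction of one component (g24) does not apply (the cross graph is
disconnected), Theorem A_sev does not (the cross edge `p₁p₂`); the two-component theorem does:
**row (SW) holds** (`sw_crossEx2`) by `sw_of_crossJunction₂`.
-/

namespace Summit.Ventures.PercRepro2

namespace CrossArm

open Hull LocRows

open scoped Classical

/-- The two-component junction: `l = 0`, `h = 1`, `o = 2`, `u = 3`, `p₁ = 4`, `p₂ = 5`, `p₃ = 6`,
`x = 7`. -/
def crossEx2 : Fin 11 → Sym2 (Fin 8)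
  | 0 => s(1, 7) | 1 => s(3, 7) | 2 => s(3, 4) | 3 => s(3, 5) | 4 => s(3, 6) | 5 => s(4, 5)
  | 6 => s(7, 0) | 7 => s(4, 0) | 8 => s(5, 0) | 9 => s(6, 0) | 10 => s(2, 0)

/-- The three dropped vertices: the component `{p₁, p₂}` and the single `p₃`. -/
def crossEx2P : Fin 2 ⊕ Fin 1 → Fin 8 := Sum.elim ![4, 5] ![6]

/-- The cross-edge graph: the edge `p₁p₂`, nothing at `p₃`. -/
abbrev crossEx2G : SimpleGraph (Fin 2 ⊕ Fin 1) := (⊤ : SimpleGraph (Fin 2)) ⊕g (⊤ : SimpleGraph (Fin 1))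

/-- An edge with no end at `c` is not an edge at `c`. -/
lemma crossEx2_no_edge_at {a b c x : Fin 8} (h : s(a, b) = s(c, x)) (ha : a ≠ c) (hb : b ≠ c) :
    False := by
  rw [Sym2.eq_iff] at h
  rcases h with ⟨h1, _⟩ | ⟨_, h2⟩
  · exact ha h1
  · exact hb h2

/-- The other end of an edge at `a`. -/
lemma crossEx2_eq_of_edge {a b x : Fin 8} (h : s(a, b) = s(a, x)) (hab : b ≠ a) : x = b := by
  rw [Sym2.eq_iff] at h
  rcases h with ⟨_, h2⟩ | ⟨h1, h2⟩
  · exact h2.symm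
  · exact absurd h2 hab

/-- The values of `crossEx2P`. -/
lemma crossEx2P_apply : crossEx2P (Sum.inl 0) = 4 ∧ crossEx2P (Sum.inl 1) = 5 ∧
    crossEx2P (Sum.inr 0) = 6 := by
  simp [crossEx2P]

/-- The cross junction of `crossEx2`, with two components. -/
theorem crossEx2_junction : CrossJunction crossEx2 ({0}ᶜ) 1 3 crossEx2P crossEx2G 2 where
  hne_hu := by decide
  hne_hp := by rintro (i | i) <;> fin_cases i <;> decide
  hne_up := by rintro (i | i) <;> fin_cases i <;> decide
  p_inj := by
    rintro (i | i) (j | j) h <;> fin_cases i <;> fin_cases j <;> first | rfl | exact absurd h (by decide)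
  hou := by decide
  hop := by rintro (i | i) <;> fin_cases i <;> decide
  hhU := by simp
  huU := by simp
  hpU := by rintro (i | i) <;> fin_cases i <;> simp [crossEx2P]
  hloop_h := by intro e; fin_cases e <;> decide
  hloop_u := by intro e; fin_cases e <;> decide
  hnadj := by intro e; fin_cases e <;> decide
  hnadj_p := by rintro (i | i) e <;> fin_cases i <;> fin_cases e <;> decide
  hup := by
    rintro (i | i) <;> fin_cases i
    · exact ⟨2, rfl⟩
    · exact ⟨3, rfl⟩
    · exact ⟨4, rfl⟩
  hcross := by
    rintro (i | i) (j | j) hij <;> fin_cases i <;> fin_cases j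
    · exact absurd hij (SimpleGraph.irrefl _)
    · exact ⟨5, rfl⟩
    · exact ⟨5, by decide⟩
    · exact absurd hij (SimpleGraph.irrefl _)
    · exact absurd hij (SimpleGraph.not_adj_sum_inl_inr _ _)
    · exact absurd hij (SimpleGraph.not_adj_sum_inl_inr _ _)
    · exact absurd hij.symm (SimpleGraph.not_adj_sum_inl_inr _ _)
    · exact absurd hij.symm (SimpleGraph.not_adj_sum_inl_inr _ _)
    · exact absurd hij (SimpleGraph.irrefl _)
  hcross_adj := by
    rintro (i | i) (j | j) e he <;> fin_cases i <;> fin_cases j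
    · exact absurd he (by revert e; decide)
    · exact SimpleGraph.sum_adj_inl.2 (by decide)
    · exact SimpleGraph.sum_adj_inl.2 (by decide)
    · exact absurd he (by revert e; decide)
    · exact absurd he (by revert e; decide)
    · exact absurd he (by revert e; decide)
    · exact absurd he (by revert e; decide)
    · exact absurd he (by revert e; decide)
    · exact absurd he (by revert e; decide)
  hcross_simple := by
    rintro (i | i) (j | j) e e' <;> revert e e' <;> fin_cases i <;> fin_cases j <;> decide
  hu_adj_h := by
    intro e x he hx
    fin_cases e <;> simp only [crossEx2] at he
    · exact (crossEx2_no_edge_at he (by decide) (by decide)).elim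
    · obtain rfl := crossEx2_eq_of_edge he (by decide)
      exact ⟨0, by decide⟩
    · obtain rfl := crossEx2_eq_of_edge he (by decide)
      exact absurd crossEx2P_apply.1.symm (hx (Sum.inl 0))
    · obtain rfl := crossEx2_eq_of_edge he (by decide)
      exact absurd crossEx2P_apply.2.1.symm (hx (Sum.inl 1))
    · obtain rfl := crossEx2_eq_of_edge he (by decide)
      exact absurd crossEx2P_apply.2.2.symm (hx (Sum.inr 0))
    all_goals exact (crossEx2_no_edge_at he (by decide) (by decide)).elim
  hp_in := by
    rintro (i | i) e x he hxU <;> fin_cases i <;> simp only [crossEx2P, Sum.elim_inl, Sum.elim_inr] at he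
    · -- `p₁ = 4`: the edges `up₁`, `p₁p₂`, `p₁l`
      fin_cases e <;> simp only [crossEx2] at he
      · exact (crossEx2_no_edge_at he (by decide) (by decide)).elim
      · exact (crossEx2_no_edge_at he (by decide) (by decide)).elim
      · rw [Sym2.eq_swap] at he
        obtain rfl := crossEx2_eq_of_edge he (by decide)
        exact Or.inl rfl
      · exact (crossEx2_no_edge_at he (by decide) (by decide)).elim
      · exact (crossEx2_no_edge_at he (by decide) (by decide)).elim
      · obtain rfl := crossEx2_eq_of_edge he (by decide)
        exact Or.inr ⟨Sum.inl 1, crossEx2P_apply.2.1.symm⟩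
      · exact (crossEx2_no_edge_at he (by decide) (by decide)).elim
      · obtain rfl := crossEx2_eq_of_edge he (by decide)
        exact absurd hxU (by simp)
      · exact (crossEx2_no_edge_at he (by decide) (by decide)).elim
      · exact (crossEx2_no_edge_at he (by decide) (by decide)).elim
      · exact (crossEx2_no_edge_at he (by decide) (by decide)).elim
    · -- `p₂ = 5`: the edges `up₂`, `p₁p₂`, `p₂l`
      fin_cases e <;> simp only [crossEx2] at he
      · exact (crossEx2_no_edge_at he (by decide) (by decide)).elim
      · exact (crossEx2_no_edge_at he (by decide) (by decide)).elim
      · exact (crossEx2_no_edge_at he (by decide) (by decide)).elim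
      · rw [Sym2.eq_swap] at he
        obtain rfl := crossEx2_eq_of_edge he (by decide)
        exact Or.inl rfl
      · exact (crossEx2_no_edge_at he (by decide) (by decide)).elim
      · rw [Sym2.eq_swap] at he
        obtain rfl := crossEx2_eq_of_edge he (by decide)
        exact Or.inr ⟨Sum.inl 0, crossEx2P_apply.1.symm⟩
      · exact (crossEx2_no_edge_at he (by decide) (by decide)).elim
      · exact (crossEx2_no_edge_at he (by decide) (by decide)).elim
      · obtain rfl := crossEx2_eq_of_edge he (by decide)
        exact absurd hxU (by simp)
      · exact (crossEx2_no_edge_at he (by decide) (by decide)).elim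
      · exact (crossEx2_no_edge_at he (by decide) (by decide)).elim
    · -- `p₃ = 6`: the edges `up₃`, `p₃l`
      fin_cases e <;> simp only [crossEx2] at he
      · exact (crossEx2_no_edge_at he (by decide) (by decide)).elim
      · exact (crossEx2_no_edge_at he (by decide) (by decide)).elim
      · exact (crossEx2_no_edge_at he (by decide) (by decide)).elim
      · exact (crossEx2_no_edge_at he (by decide) (by decide)).elim
      · rw [Sym2.eq_swap] at he
        obtain rfl := crossEx2_eq_of_edge he (by decide)
        exact Or.inl rfl
      · exact (crossEx2_no_edge_at he (by decide) (by decide)).elim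
      · exact (crossEx2_no_edge_at he (by decide) (by decide)).elim
      · exact (crossEx2_no_edge_at he (by decide) (by decide)).elim
      · exact (crossEx2_no_edge_at he (by decide) (by decide)).elim
      · obtain rfl := crossEx2_eq_of_edge he (by decide)
        exact absurd hxU (by simp)
      · exact (crossEx2_no_edge_at he (by decide) (by decide)).elim
  hout := by
    intro x hx hx1 hx2 hx3
    simp only [Set.mem_compl_iff, Set.mem_singleton_iff] at hx
    fin_cases x
    · exact absurd rfl hx
    · exact absurd rfl hx1
    · exact absurd rfl hx2
    · exact absurd rfl hx3
    · exact Or.inl ⟨7, 0, rfl, by simp⟩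
    · exact Or.inl ⟨8, 0, rfl, by simp⟩
    · exact Or.inl ⟨9, 0, rfl, by simp⟩
    · exact Or.inl ⟨6, 0, rfl, by simp⟩

/-- The cross-edge graph of `crossEx2` is NOT connected: the one-component theorem
`sw_of_crossJunction` (g24) does not apply to it. -/
theorem crossEx2G_not_connected : ¬ crossEx2G.Connected := SimpleGraph.not_connected_sum

/-- **Row (SW) on a junction with a cross edge and a single dropped vertex** (two components). -/
theorem sw_crossEx2 : Sw crossEx2 0 1 2 :=
  sw_of_crossJunction₂ SimpleGraph.connected_top SimpleGraph.connected_top (by decide)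
    crossEx2_junction

end CrossArm

end Summit.Ventures.PercRepro2
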